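import Mathlib.Analysis.Complex.CauchyIntegral
import Mathlib.Analysis.Analytic.Uniqueness
import Literature.Topology.Euclidean.PlanarStaircase
import HarnessLib

/-!
# Continuations agree off a finite set (socket #47a of the s5 seam, hLiu418)

Track B ∕ hLiu418 = stmt-HodgeConjecture-24832, line `K2_Liu_CurveThetaSigs`, unit U6 «FIRST TERM AT THE TOP POLE: THE s5 SEAM»
(`Cruxes/HLiu418/Lines/K2_Liu_CurveThetaSigs_U6_FirstTerm.lean`, ED. 1), socket #47a `sig_K2LiuContinuationsAgree` (SUPPORT
«CONTINUATIONS AGREE OFF A FINITE SET», size S–M, pure Mathlib + ★ `Literature.Topology.Euclidean.PlanarStaircase`), seat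
`hodgecm-mathlib-K2Liu-p06` (g0).

**Identity principle on convex domains minus finitely many points.** `U, Ω ⊆ ℂ` open and convex, both containing the right half-plane
`{Re s > s₁}`; `P` finite; `Z₁` holomorphic on `U ∖ P`, `Z₂` holomorphic on `Ω ∖ P`, `Z₁ = Z₂` on `{Re s > s₁}`: then `Z₁ = Z₂` on `(U ∩ Ω) ∖ P`.
Proof: `U ∩ Ω` is open and convex, hence preconnected; an open preconnected planar set minus finitely many points stays preconnected
(★ `Literature.Topology.Euclidean.isPreconnected_diff_finite`, the planar staircase file); `Z₁ − Z₂` is analytic on the open connected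
`(U ∩ Ω) ∖ P` (`DifferentiableOn.analyticOnNhd`) and vanishes on the non-empty open subset `{Re s > s₁} ∖ P`, hence identically
(`AnalyticOnNhd.eqOn_zero_of_preconnected_of_eventuallyEq_zero`). In the s5 seam `Z₁ = Zc` (the doubling zeta integral's continuation on
`U ∖ {½}`) and `Z₂ = (E⋆-pairing) ∕ ∏(s−p)` on `Ω = {Re s > 0}` [Liu2021, Lem. B.12]; this is why the line's domain `U` is CONVEX (LEAD lesson (V7)).

Theorems only; axioms ⊆ {propext, Classical.choice, Quot.sound}. The statement of `continuationsAgree` is the socket's, byte for byte.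

HONEST LABEL: HC_CM is proved only modulo the 7 printed citations (2 remaining named inputs: hLiu418 = stmt-HodgeConjecture-24832,
h413 = stmt-HodgeConjecture-24833) until rung 0 closes; this support file moves no counter.
-/

noncomputable section

set_option autoImplicit false

set_option linter.dupNamespace false

open Set Filter
open scoped Topology
open Literature.Topology.Euclidean

namespace Summit.HodgeConjecture.HodgeConjecture.Cruxes.HLiu418.K2LiuContinuationsAgree

/-- In `ℂ`: an open convex set minus a finite set is preconnected (★ planar staircase lemma for open preconnected sets, convex sets being
preconnected). [folklore] -/
theorem isPreconnected_convex_diff_finite {C : Set ℂ} (hC : IsOpen C) (hCc : Convex ℝ C) {P : Set ℂ} (hP : P.Finite) :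
    IsPreconnected (C \ P) :=
  isPreconnected_diff_finite hC hCc.isPreconnected hP

/-- The open set `{Re s > s₁} ∖ P` is non-empty for `P` finite (a non-empty open planar set is infinite). [folklore] -/
theorem nonempty_halfPlane_diff_finite (s₁ : ℝ) {P : Set ℂ} (hP : P.Finite) :
    ({s : ℂ | s₁ < s.re} \ P).Nonempty := by
  refine ((infinite_of_isOpen (isOpen_lt continuous_const Complex.continuous_re) ⟨((s₁ + 1 : ℝ) : ℂ), ?_⟩).sdiff hP).nonempty
  simp only [mem_setOf_eq, Complex.ofReal_re, lt_add_iff_pos_right, zero_lt_one]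

/-- **Socket #47a `sig_K2LiuContinuationsAgree` — CONTINUATIONS AGREE OFF A FINITE SET.** `U, Ω ⊆ ℂ` open convex containing `{Re s > s₁}`,
`P` finite, `Z₁` holomorphic on `U ∖ P`, `Z₂` holomorphic on `Ω ∖ P`, `Z₁ = Z₂` on `{Re s > s₁}` ⇒ `Z₁ = Z₂` on `(U ∩ Ω) ∖ P` (identity theorem
on the open connected set `(U ∩ Ω) ∖ P` for the analytic `Z₁ − Z₂`, which vanishes on the non-empty open subset `{Re s > s₁} ∖ P`).
[cite: Liu2021, Lem. B.12 pp. 103–104] -/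
theorem continuationsAgree :
    ∀ (U Ω : Set ℂ) (P : Set ℂ), P.Finite → IsOpen U → Convex ℝ U → IsOpen Ω → Convex ℝ Ω →
      ∀ (s₁ : ℝ), {s : ℂ | s₁ < s.re} ⊆ U → {s : ℂ | s₁ < s.re} ⊆ Ω →
      ∀ (Z₁ Z₂ : ℂ → ℂ), DifferentiableOn ℂ Z₁ (U \ P) → DifferentiableOn ℂ Z₂ (Ω \ P) →
        (∀ s : ℂ, s₁ < s.re → Z₁ s = Z₂ s) →
        Set.EqOn Z₁ Z₂ ((U ∩ Ω) \ P) := by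
  intro U Ω P hP hU hUc hΩ hΩc s₁ hHU hHΩ Z₁ Z₂ hZ₁ hZ₂ heq
  set D : Set ℂ := (U ∩ Ω) \ P with hDdef
  have hDopen : IsOpen D := (hU.inter hΩ).sdiff hP.isClosed
  have hDconn : IsPreconnected D := isPreconnected_convex_diff_finite (hU.inter hΩ) (hUc.inter hΩc) hP
  -- the difference is analytic on `D`
  have hdiff : DifferentiableOn ℂ (fun s => Z₁ s - Z₂ s) D :=
    (hZ₁.mono (sdiff_subset_sdiff_left inter_subset_left)).sub
      (hZ₂.mono (sdiff_subset_sdiff_left inter_subset_right))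
  have han : AnalyticOnNhd ℂ (fun s => Z₁ s - Z₂ s) D := hdiff.analyticOnNhd hDopen
  -- a base point in the open set `{Re s > s₁} ∖ P ⊆ D`, where the difference vanishes
  have hHopen : IsOpen ({s : ℂ | s₁ < s.re} \ P) :=
    (isOpen_lt continuous_const Complex.continuous_re).sdiff hP.isClosed
  obtain ⟨z₀, hz₀⟩ := nonempty_halfPlane_diff_finite s₁ hP
  have hz₀D : z₀ ∈ D := ⟨⟨hHU hz₀.1, hHΩ hz₀.1⟩, hz₀.2⟩
  have hev : (fun s => Z₁ s - Z₂ s) =ᶠ[𝓝 z₀] 0 := by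
    filter_upwards [hHopen.mem_nhds hz₀] with s hs
    exact sub_eq_zero.2 (heq s hs.1)
  have hzero := han.eqOn_zero_of_preconnected_of_eventuallyEq_zero hDconn hz₀D hev
  intro w hw
  exact sub_eq_zero.1 (hzero hw)

end Summit.HodgeConjecture.HodgeConjecture.Cruxes.HLiu418.K2LiuContinuationsAgree

end
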